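import Summits.CriticalPhenomena.SAWScalingLimit.Theorems.SAWLoopFugacityFlowIsingBoundaryRatioFrameAdjUnif
import Summits.CriticalPhenomena.SAWScalingLimit.Theorems.SAWLoopFugacityFlowIsingBoundaryRatioFrameLadder
import Summits.CriticalPhenomena.SAWScalingLimit.Theorems.SAWLoopFugacityFlowIsingBoundaryRatioAnchorWalk
import Summits.CriticalPhenomena.SAWScalingLimit.Theorems.SAWLoopFugacityFlowIsingBoundaryRatioHeartWindow
import Summits.CriticalPhenomena.SAWScalingLimit.Theorems.SAWLoopFugacityFlowIsingBoundaryRatioHeartHelpers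
import Summits.CriticalPhenomena.SAWScalingLimit.Theorems.SAWLoopFugacityFlowIsingBoundaryRatioChartDiscOneComponent
import Literature.Analysis.Convexity.KestenSupersolution
import Literature.Probability.RandomPlanarGeometry.CaratheodoryHalfPlaneProofs
import Literature.Probability.Percolation.Crossings
import Literature.Probability.Percolation.BlockExplorationBasic
import HarnessLib

/-!
# The FK heart of the line `fk-anchor-transfer`, assembled (crux `SAWLoopFugacityFlow.IsingBoundaryRatio`,
stmt-CriticalPhenomena-10650)

`stub_fkArmOriginForgettingBS` — arm-origin forgetting for the free critical FK–Ising model at the marked prime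
end of a Dobrushin domain — from the two abstract bricks of Kesten's ratio-limit scheme over scale frames
(ABS-A `insideRatio_osc_le`: one-frame ratio forgetting; ABS-TWO `ratio_forgetting_two_graphs`: the two-graph
comparison across a window), here taken as the hypotheses `hABSA`, `hTWO` (their registered statements,
verbatim), and the chart geometry of the line: GEO-1 (`eventually_chartFrame_adj_unif`), GEO-2
(`eventually_chartFrame_ladderRSW`), GEO-3 (`eventually_anchor_walk`), the common window
(`exists_common_window`) and the explicit supersolution (`exists_supersolution_le`). The parameter choice
follows Kesten 1986, §2: modulus `M` and RSW constant `c₁` first, then the cross-ratio constant `K = 2⁸/c₁²⁰`,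
the number of levels `L` and junk threshold (supersolution `≤ 1 + η/8`), then the block thickness `m`
(junk rate `(1-c₁)^(m/2)`), then the ladder length `n = L(m+18)+m+1`; only then the geometric scales: frame
ball `ε/2`, chart ceiling `R` (GEO-1, the window, the exclusion of the far targets), the base scale `a` under
`R/(4Mⁿ)` and GEO-2's `ρ₀`, the frame modulus `η_f = a/2`, the anchor radius `r` (GEO-3, the window, mesh
membership of the anchors), and the mesh range. Folklore bookkeeping; no new definitions.
-/

noncomputable section

open scoped Classical Topology
open Filter Set Metric SimpleGraph MeasureTheory Finset
open Literature.Probability.LatticeModels Literature.Probability.RandomPlanarGeometry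
open Literature.Probability.Percolation (BondConfig openConn openConnIn openCrossing explEvent)
open UpperHalfPlane (upperHalfPlaneSet)

namespace Summit.CriticalPhenomena.SAWScalingLimit.Theorems.IsingBoundaryRatio

/-- Elementary: `QL ≤ 1 + η/8`, `0 ≤ e ≤ η/16`, `0 < η ≤ 1` give `QL/(1-e)² ≤ 1 + η/2`. [folklore] -/
theorem div_sq_le_of_small : ∀ {QL e η : ℝ}, QL ≤ 1 + η / 8 → 0 ≤ e → e ≤ η / 16 → 0 < η → η ≤ 1 →
    QL / (1 - e) ^ 2 ≤ 1 + η / 2 := by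
  intro QL e η hQL he0 he hη hη1
  have hden : 1 - η / 8 ≤ (1 - e) ^ 2 := by nlinarith
  have hden0 : 0 < 1 - η / 8 := by linarith
  rw [div_le_iff₀ (hden0.trans_le hden)]
  calc QL ≤ 1 + η / 8 := hQL
    _ ≤ (1 + η / 2) * (1 - η / 8) := by nlinarith
    _ ≤ (1 + η / 2) * (1 - e) ^ 2 := mul_le_mul_of_nonneg_left hden (by linarith)

set_option maxHeartbeats 400000 in
/-- **The FK heart, assembled modulo the two abstract ratio-forgetting bricks** (see the module docstring):
`hABSA` is the registered statement of `insideRatio_osc_le`, `hTWO` that of `ratio_forgetting_two_graphs`;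
from them and the landed chart geometry, `ChartAnnulusSeparation → RoughHalfAnnulusRSWMeshLargeOf AnnPathSepG →
HalfAnnulusRadialCrossingBoundFat → RoughHalfAnnulusRSWLargeOf AnnPathSepG → ∀ D, FKArmOriginForgettingAt D.carrier (D.pt 0)`
(the first and last hypotheses are not needed by this route and are kept for the registered shape). [folklore] -/
theorem fkArmOriginForgettingBS_of
    (hABSA : ∀ {V : Type} [Fintype V] [DecidableEq V] (F : ScaleFrame V) {p q c a M : ℝ} {m g L : ℕ}, p ∈ Set.Ico (0 : ℝ) 1 → 1 ≤ q → 0 < c → c ≤ 1 → 0 < a → 4 ≤ M → 2 ≤ m → 1 ≤ g → 1 ≤ L → (1 - c) ^ (m / 2) < 1 → a * M ^ (L * (m + 17 + g) + m + 1) ≤ F.Rmax → F.η ≤ a → F.LadderRSWb p q c a M (L * (m + 17 + g) + m + 1) 13 → ∀ (x x' : V), (∃ w : (fromEdgeSet (↑F.E : Set (Sym2 V))).Walk x x', ∀ z ∈ w.support, z ∈ F.good ∧ F.rad z < a - F.η) → ∀ (Q : ℕ → ℝ), q ^ 8 / c ^ 20 / (1 - (1 - c) ^ (m / 2)) ^ 2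 ≤ Q 1 → (∀ l : ℕ, 1 ≤ l → l < L → (1 / (q ^ 8 / c ^ 20) + (1 - 1 / (q ^ 8 / c ^ 20)) * Q l) / (1 - (1 - c) ^ (m / 2)) ^ 2 ≤ Q (l + 1)) → let P := rcMeasure (fromEdgeSet (↑F.E : Set (Sym2 V))) p q ∅; let aL : ℝ := a * M ^ (L * (m + 17 + g)); let Fd : Set V → Set V → Set (BondConfig V) := fun U R => {ω | ω ∩ (↑F.E : Set (Sym2 V)) ∈ explEvent (F.inSet aL) (F.annSet aL (aL * M ^ m)) U R ∩ {ω | ∀ r ∈ R, ∀ r₂ ∈ R, ∃ v ∈ U \ F.inSet aL, ∃ v' ∈ U \ F.inSet aL, s(v, r) ∈ ω ∧ s(v', r₂) ∈ ω ∧ ω ∈ openConnIn (U \ F.inSet aL) v v'}}; let InP : V → Set V → Set V → Set (BondConfig V) := fun y U R => {ω | ∃ w ∈ R, ∃ v ∈ U, ω ∩ (↑F.E : Set (Sym2 V)) ∈ openConnIn U y v ∧ s(v, w) ∈ ω ∩ (↑F.E : Set (Sym2 V))}; let u : V → Set V → Set V → ℝ := fun y U R => P.real (Fd U R ∩ InP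 y U R) / P.real (Fd U R); ∀ (U R U₂ R₂ : Set V), 0 < u x U R → 0 < u x U₂ R₂ → u x U R * u x' U₂ R₂ ≤ Q L * (u x' U R * u x U₂ R₂))
    (hTWO : ∀ {V₁ V₂ Wt : Type} [Fintype V₁] [DecidableEq V₁] [Fintype V₂] [DecidableEq V₂] [Fintype Wt] [DecidableEq Wt] (G₁ : SimpleGraph V₁) [DecidableRel G₁.Adj] (G₂ : SimpleGraph V₂) [DecidableRel G₂.Adj] (ι₁ : Wt ↪ V₁) (ι₂ : Wt ↪ V₂) (W₀ : Set Wt) (F₁ : ScaleFrame V₁) (F₂ : ScaleFrame V₂) {p q c a M : ℝ} {m g L : ℕ} (Q : ℕ → ℝ) (x x' : Wt) (y₁ : V₁) (y₂ : V₂), (∀ {V : Type} [Fintype V] [DecidableEq V] (F : ScaleFrame V) {p q c a M : ℝ} {m g L : ℕ}, p ∈ Set.Ico (0 : ℝ) 1 → 1 ≤ q → 0 < c → c ≤ 1 → 0 < a → 4 ≤ M → 2 ≤ m → 1 ≤ g → 1 ≤ L → (1 - c) ^ (m / 2) < 1 → a * M ^ (L * (m + 17 + g) + m + 1) ≤ F.Rmax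 → F.η ≤ a → F.LadderRSWb p q c a M (L * (m + 17 + g) + m + 1) 13 → ∀ (x x' : V), (∃ w : (fromEdgeSet (↑F.E : Set (Sym2 V))).Walk x x', ∀ z ∈ w.support, z ∈ F.good ∧ F.rad z < a - F.η) → ∀ (Q : ℕ → ℝ), q ^ 8 / c ^ 20 / (1 - (1 - c) ^ (m / 2)) ^ 2 ≤ Q 1 → (∀ l : ℕ, 1 ≤ l → l < L → (1 / (q ^ 8 / c ^ 20) + (1 - 1 / (q ^ 8 / c ^ 20)) * Q l) / (1 - (1 - c) ^ (m / 2)) ^ 2 ≤ Q (l + 1)) → let P := rcMeasure (fromEdgeSet (↑F.E : Set (Sym2 V))) p q ∅; let aL : ℝ := a * M ^ (L * (m + 17 + g)); let Fd : Set V → Set V → Set (BondConfig V) := fun U R => {ω | ω ∩ (↑F.E : Set (Sym2 V)) ∈ explEvent (F.inSet aL) (F.annSet aL (aL * M ^ m)) U R ∩ {ω | ∀ r ∈ R, ∀ r₂ ∈ R, ∃ v ∈ U \ F.inSet aL, ∃ v' ∈ U \ F.inSet aL, s(v, r) ∈ ω ∧ s(v', r₂) ∈ ω ∧ ω ∈ openConnIn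 (U \ F.inSet aL) v v'}}; let InP : V → Set V → Set V → Set (BondConfig V) := fun y U R => {ω | ∃ w ∈ R, ∃ v ∈ U, ω ∩ (↑F.E : Set (Sym2 V)) ∈ openConnIn U y v ∧ s(v, w) ∈ ω ∩ (↑F.E : Set (Sym2 V))}; let u : V → Set V → Set V → ℝ := fun y U R => P.real (Fd U R ∩ InP y U R) / P.real (Fd U R); ∀ (U R U₂ R₂ : Set V), 0 < u x U R → 0 < u x U₂ R₂ → u x U R * u x' U₂ R₂ ≤ Q L * (u x' U R * u x U₂ R₂)) → p ∈ Set.Ioo (0 : ℝ) 1 → 1 ≤ q → 0 < c → c ≤ 1 → 0 < a → 4 ≤ M → 2 ≤ m → 1 ≤ g → 1 ≤ L → (1 - c) ^ (m / 2) < 1 → a * M ^ (L * (m + 17 + g) + m + 1) ≤ F₁.Rmax → a * M ^ (L * (m + 17 + g) + m + 1) ≤ F₂.Rmax → F₁.η ≤ a → F₂.η ≤ a → F₁.E = G₁.edgeFinset → F₂.E = G₂.edgeFinset → F₁.LadderRSWb p q c a M (L * (m + 17 + g) + m + 1) 13 → F₂.LadderRSWb p q c a M (L * (m + 17 + g) +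 m + 1) 13 → (∀ a b : Wt, G₁.Adj (ι₁ a) (ι₁ b) ↔ G₂.Adj (ι₂ a) (ι₂ b)) → (∀ w ∈ W₀, ∀ v : V₁, G₁.Adj (ι₁ w) v → ∃ b : Wt, v = ι₁ b) → (∀ w ∈ W₀, ∀ v : V₂, G₂.Adj (ι₂ w) v → ∃ b : Wt, v = ι₂ b) → (∀ w : Wt, F₁.rad (ι₁ w) = F₂.rad (ι₂ w)) → (∀ w : Wt, ι₁ w ∈ F₁.good ↔ ι₂ w ∈ F₂.good) → (∀ v : V₁, v ∈ F₁.good → F₁.rad v < a * M ^ (L * (m + 17 + g)) * M ^ m + 2 * F₁.η → ∃ w ∈ W₀, v = ι₁ w) → (∀ v : V₂, v ∈ F₂.good → F₂.rad v < a * M ^ (L * (m + 17 + g)) * M ^ m + 2 * F₂.η → ∃ w ∈ W₀, v = ι₂ w) → (∃ w : (fromEdgeSet (↑F₁.E : Set (Sym2 V₁))).Walk (ι₁ x) (ι₁ x'), ∀ z ∈ w.support, z ∈ F₁.good ∧ F₁.rad z < a - F₁.η) → (∃ w : (fromEdgeSet (↑F₂.E : Set (Sym2 V₂))).Walk (ι₂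 x) (ι₂ x'), ∀ z ∈ w.support, z ∈ F₂.good ∧ F₂.rad z < a - F₂.η) → (y₁ ∈ F₁.good → a * M ^ (L * (m + 17 + g)) * M ^ m + F₁.η ≤ F₁.rad y₁) → (y₂ ∈ F₂.good → a * M ^ (L * (m + 17 + g)) * M ^ m + F₂.η ≤ F₂.rad y₂) → 0 < (rcMeasure G₁ p q ∅).real (openConn (ι₁ x) y₁) → 0 < (rcMeasure G₁ p q ∅).real (openConn (ι₁ x') y₁) → 0 < (rcMeasure G₂ p q ∅).real (openConn (ι₂ x) y₂) → 0 < (rcMeasure G₂ p q ∅).real (openConn (ι₂ x') y₂) → q ^ 8 / c ^ 20 / (1 - (1 - c) ^ (m / 2)) ^ 2 ≤ Q 1 → (∀ l : ℕ, 1 ≤ l → l < L → (1 / (q ^ 8 / c ^ 20) + (1 - 1 / (q ^ 8 / c ^ 20)) * Q l) / (1 - (1 - c) ^ (m / 2)) ^ 2 ≤ Q (l + 1)) → (rcMeasure G₁ p q ∅).real (openConn (ι₁ x) y₁) * (rcMeasure G₂ p q ∅).real (openConn (ι₂ x') y₂) ≤ Q L / (1 - (1 - c) ^ (m / 2)) ^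 2 * ((rcMeasure G₁ p q ∅).real (openConn (ι₁ x') y₁) * (rcMeasure G₂ p q ∅).real (openConn (ι₂ x) y₂))) :
    ChartAnnulusSeparation → RoughHalfAnnulusRSWMeshLargeOf AnnPathSepG → HalfAnnulusRadialCrossingBoundFat →
      RoughHalfAnnulusRSWLargeOf AnnPathSepG →
      ∀ (D : DobrushinDomain), FKArmOriginForgettingAt D.carrier (D.pt 0) := by
  intro _h1a hmesh hfat _hcond D ε c η hε hc hη
  -- WLOG `η ≤ 1`
  set η' : ℝ := min η 1 with hη'def
  have hη' : 0 < η' := lt_min hη one_pos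
  have hη'1 : η' ≤ 1 := min_le_right _ _
  have hη'η : η' ≤ η := min_le_left _ _
  -- the critical parameters
  set p : ℝ := 1 - Real.exp (-2 * criticalBetaTwo) with hpdef
  have hp0 : 0 < p := by
    rw [hpdef, sub_pos]
    exact Real.exp_lt_one_iff.2 (by linarith [criticalBetaTwo_pos])
  have hp1 : p < 1 := by rw [hpdef]; linarith [Real.exp_pos (-2 * criticalBetaTwo)]
  -- the chordal chart
  obtain ⟨φ, hφ⟩ := MarkedDomain.exists_isChordalUniformizing_holds D
  -- (1) modulus and RSW constant
  obtain ⟨M₀, hM₀, hG2⟩ := eventually_chartFrame_ladderRSW D φ hφ hmesh hfat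
  set M : ℝ := max M₀ 4 with hMdef
  have hM4 : 4 ≤ M := le_max_right _ _
  have hM1 : 1 ≤ M := by linarith
  have hM0 : 0 < M := by linarith
  obtain ⟨c₀, hc₀, hG2'⟩ := hG2 M (le_max_left _ _)
  set c₁ : ℝ := min c₀ (1 / 2) with hc₁def
  have hc₁ : 0 < c₁ := lt_min hc₀ (by norm_num)
  have hc₁1 : c₁ ≤ 1 := (min_le_right _ _).trans (by norm_num)
  have hc₁c₀ : c₁ ≤ c₀ := min_le_left _ _
  have h1c₁ : 1 - c₁ < 1 := by linarith
  have h1c₁0 : 0 ≤ 1 - c₁ := by linarith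
  -- (2) cross-ratio constant, levels, junk threshold
  set K : ℝ := 2 ^ 8 / c₁ ^ 20 with hKdef
  have hK1 : 1 ≤ K := by
    rw [hKdef, le_div_iff₀ (by positivity), one_mul]
    calc c₁ ^ 20 ≤ 1 ^ 20 := pow_le_pow_left₀ hc₁.le hc₁1 20
      _ ≤ 2 ^ 8 := by norm_num
  obtain ⟨L, hL1, ε₀, hε₀, hQex⟩ := Literature.Analysis.Convexity.Doeblin.exists_supersolution_le
    hK1 (show 0 < η' / 8 by positivity) (by linarith)
  -- (3) block thickness: junk rate `(1 - c₁)^(m/2) ≤ min ε₀ (η'/16)`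
  obtain ⟨k, hk⟩ := exists_pow_lt_of_lt_one (show 0 < min ε₀ (η' / 16) by positivity) h1c₁
  set m : ℕ := 2 * (k + 1) with hmdef
  have hm2 : 2 ≤ m := by omega
  have hmk : m / 2 = k + 1 := by omega
  set εJ : ℝ := (1 - c₁) ^ (m / 2) with hεJdef
  have hεJ_le : εJ ≤ min ε₀ (η' / 16) := by
    rw [hεJdef, hmk, pow_succ]
    calc (1 - c₁) ^ k * (1 - c₁) ≤ (1 - c₁) ^ k * 1 :=
          mul_le_mul_of_nonneg_left h1c₁.le (pow_nonneg h1c₁0 k)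
      _ ≤ min ε₀ (η' / 16) := by rw [mul_one]; exact hk.le
  have hεJ0 : 0 ≤ εJ := pow_nonneg h1c₁0 _
  have hεJ1 : εJ < 1 := by
    have : εJ ≤ η' / 16 := hεJ_le.trans (min_le_right _ _)
    linarith
  obtain ⟨Q, hQ1, hQstep, hQL⟩ := hQex εJ hεJ0 (hεJ_le.trans (min_le_left _ _))
  -- (4) ladder length (with gap `g = 1`)
  set n : ℕ := L * (m + 17 + 1) + m + 1 with hndef
  -- (5) the frame ball `ε/2`, the chart ceiling `R`
  have hε2 : 0 < ε / 2 := half_pos hε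
  obtain ⟨R₁, hR₁, hG1⟩ := eventually_chartFrame_adj_unif D φ hφ (ε / 2) hε2
  obtain ⟨R₀w, hR₀w, hWin⟩ := exists_common_window D φ hφ stub_chartDiscOneComponent ε hε
  obtain ⟨Rc, hRc, hRc'⟩ := exists_forall_dist_lt_of_norm_symm_lt hφ (show 0 < min c (ε / 2) by positivity)
  set R : ℝ := min (min R₁ Rc) (R₀w / 2) with hRdef
  have hR : 0 < R := by positivity
  have hRR₁ : R ≤ R₁ := (min_le_left _ _).trans (min_le_left _ _)
  have hRRc : R ≤ Rc := (min_le_left _ _).trans (min_le_right _ _)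
  have hRw : R < R₀w := (min_le_right _ _).trans_lt (half_lt_self hR₀w)
  -- (6) the base scale `a`, the frame modulus `η_f = a/2`
  obtain ⟨ρ₀, hρ₀, hG2''⟩ := hG2' n (ε / 2) hε2
  have hMn : 0 < M ^ n := pow_pos hM0 n
  set a : ℝ := min (ρ₀ / 2) (R / (4 * M ^ n)) with hadef
  have ha : 0 < a := by positivity
  have haρ₀ : a < ρ₀ := (min_le_left _ _).trans_lt (half_lt_self hρ₀)
  have haR : M ^ n * a ≤ R / 4 := by
    have : a ≤ R / (4 * M ^ n) := min_le_right _ _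
    rw [le_div_iff₀ (by positivity)] at this
    linarith
  have hηf : 0 < a / 2 := half_pos ha
  -- (7) the anchor radius
  obtain ⟨rw, hrw, hWin'⟩ := hWin R hR hRw
  obtain ⟨r₃, hr₃, hG3⟩ := eventually_anchor_walk D φ hφ stub_chartDiscOneComponent (ε / 2) (a / 2) hε2 hηf
  -- small distance ⇒ small chart radius (for the anchors, at radius `R`)
  obtain ⟨rR, hrR, hrR'⟩ : ∃ r : ℝ, 0 < r ∧ ∀ z ∈ D.carrier, dist z (D.pt 0) < r → ‖φ.symm z‖ < R := by
    obtain ⟨r, hr, h⟩ := Metric.tendsto_nhdsWithin_nhds.1 hφ.tendsto_symm_nhds_zero R hR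
    exact ⟨r, hr, fun z hz hzr => by simpa [dist_zero_right] using h hz hzr⟩
  set r : ℝ := min (min (min rw r₃) (min rR (c / 2))) (ε / 2) with hrdef
  have hr : 0 < r := by positivity
  have hr_rw : r ≤ rw := by simp only [hrdef]; exact (min_le_left _ _).trans ((min_le_left _ _).trans (min_le_left _ _))
  have hr_r₃ : r ≤ r₃ := by simp only [hrdef]; exact (min_le_left _ _).trans ((min_le_left _ _).trans (min_le_right _ _))
  have hr_rR : r ≤ rR := by simp only [hrdef]; exact (min_le_left _ _).trans ((min_le_right _ _).trans (min_le_left _ _))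
  have hr_c : r ≤ c / 2 := by simp only [hrdef]; exact (min_le_left _ _).trans ((min_le_right _ _).trans (min_le_right _ _))
  have hr_ε : r ≤ ε / 2 := min_le_right _ _
  refine ⟨r, hr, ?_⟩
  -- (8) the mesh range
  filter_upwards [hG1 (a / 2) hηf, hG2'' a ha haρ₀, hG3, hWin'] with δ hδ1 hδ2 hδ3 hδw
  intro G₁ _ G₂ _ Λ₁ Λ₂ x x' y₁ y₂ hLA₁ hLA₂ hx₁ hx₂ hx'₁ hx'₂ hy₁ hy₂ hdx hdx' hdy₁ hdy₂ w₁ w₁' w₂ w₂'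
  -- ===== the two finite volumes =====
  have hr_lt_c : r < c := by linarith
  have hxball : meshPoint δ x ∈ Metric.ball (D.pt 0) ε := by
    rw [Metric.mem_ball]; linarith [hdx, hr_ε]
  have hx'ball : meshPoint δ x' ∈ Metric.ball (D.pt 0) ε := by
    rw [Metric.mem_ball]; linarith [hdx', hr_ε]
  -- the anchors are vertices of `Ω_δ` (they carry an edge of `G₁`, read through local agreement)
  have mesh_of_walk : ∀ {u : Site 2} {t : Site 2}, u ∈ Λ₁ → meshPoint δ u ∈ Metric.ball (D.pt 0) ε →
      dist (meshPoint δ u) (D.pt 0) < r → c ≤ dist (meshPoint δ t) (D.pt 0) →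
      (∃ w : G₁.Walk u t, ∀ v ∈ w.support, v ∈ Λ₁) → u ∈ meshDomain D.carrier δ := by
    rintro u t hu hub hud htd ⟨w, -⟩
    cases w with
    | nil => exact absurd (hud.trans hr_lt_c) (not_lt.2 htd)
    | cons h _ => exact (discreteDomainGraph_adj_iff.1 ((hLA₁ u hu hub _).1.1 h)).2.1
  have hxm : x ∈ meshDomain D.carrier δ := mesh_of_walk hx₁ hxball hdx hdy₁ w₁
  have hx'm : x' ∈ meshDomain D.carrier δ := mesh_of_walk hx'₁ hx'ball hdx' hdy₁ w₁'
  have hxD : meshPoint δ x ∈ D.carrier := meshDomain_subset_meshVertices _ _ hxm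
  have hx'D : meshPoint δ x' ∈ D.carrier := meshDomain_subset_meshVertices _ _ hx'm
  -- local agreement in the frame ball `ε/2`
  have hLA₁' : LocalAgreement D.carrier (D.pt 0) (ε / 2) δ G₁ Λ₁ := localAgreement_of_le hLA₁ (by linarith)
  have hLA₂' : LocalAgreement D.carrier (D.pt 0) (ε / 2) δ G₂ Λ₂ := localAgreement_of_le hLA₂ (by linarith)
  -- the adjacency axiom with ceiling `R ≤ R₁`
  have hadj₁ : ∀ e ∈ (G₁.comap (Subtype.val : ↥Λ₁ → Site 2)).edgeFinset, ∀ u ∈ e, ∀ v ∈ e,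
      (u.1 ∈ meshDomain D.carrier δ ∧ meshPoint δ u.1 ∈ Metric.ball (D.pt 0) (ε / 2)) →
      ‖φ.symm (meshPoint δ u.1)‖ < R →
        (v.1 ∈ meshDomain D.carrier δ ∧ meshPoint δ v.1 ∈ Metric.ball (D.pt 0) (ε / 2)) ∧
          |‖φ.symm (meshPoint δ v.1)‖ - ‖φ.symm (meshPoint δ u.1)‖| < a / 2 :=
    fun e he u hu v hv hg huR => hδ1 G₁ Λ₁ hLA₁' e he u hu v hv hg (huR.trans_le hRR₁)
  have hadj₂ : ∀ e ∈ (G₂.comap (Subtype.val : ↥Λ₂ → Site 2)).edgeFinset, ∀ u ∈ e, ∀ v ∈ e,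
      (u.1 ∈ meshDomain D.carrier δ ∧ meshPoint δ u.1 ∈ Metric.ball (D.pt 0) (ε / 2)) →
      ‖φ.symm (meshPoint δ u.1)‖ < R →
        (v.1 ∈ meshDomain D.carrier δ ∧ meshPoint δ v.1 ∈ Metric.ball (D.pt 0) (ε / 2)) ∧
          |‖φ.symm (meshPoint δ v.1)‖ - ‖φ.symm (meshPoint δ u.1)‖| < a / 2 :=
    fun e he u hu v hv hg huR => hδ1 G₂ Λ₂ hLA₂' e he u hu v hv hg (huR.trans_le hRR₁)
  -- ===== the common window =====
  obtain ⟨Wt, hW₁, hW₂, hxW, hadjW, hnbrW, hcoreW, hdiscW, -⟩ :=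
    hδw G₁ G₂ Λ₁ Λ₂ x hLA₁ hLA₂ hx₁ hx₂ hxm (hdx.trans_le hr_rw)
  have hx'W : x' ∈ Wt :=
    (hcoreW x' (Or.inl hx'₁) hx'm (by rw [Metric.mem_ball]; linarith [hdx', hr_ε])
      (hrR' _ hx'D (hdx'.trans_le hr_rR))).1
  let ι₁ : ↥Wt ↪ ↥Λ₁ := ⟨fun w => ⟨w.1, hW₁ w.2⟩, fun w w' h => Subtype.ext (by simpa using congrArg Subtype.val h)⟩
  let ι₂ : ↥Wt ↪ ↥Λ₂ := ⟨fun w => ⟨w.1, hW₂ w.2⟩, fun w w' h => Subtype.ext (by simpa using congrArg Subtype.val h)⟩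
  let W₀ : Set ↥Wt := {w | meshPoint δ w.1 ∈ Metric.ball (D.pt 0) (3 * ε / 4)}
  let xW : ↥Wt := ⟨x, hxW⟩
  let x'W : ↥Wt := ⟨x', hx'W⟩
  -- ===== scale arithmetic =====
  have hMn1 : 1 ≤ M ^ n := one_le_pow₀ hM1
  have haR4 : a ≤ R / 4 := by
    have h1 : a ≤ R / (4 * M ^ n) := min_le_right _ _
    have h2 : R / (4 * M ^ n) ≤ R / 4 := by
      apply div_le_div_of_nonneg_left hR.le (by norm_num)
      have : (4 : ℝ) * 1 ≤ 4 * M ^ n := mul_le_mul_of_nonneg_left hMn1 (by norm_num)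
      linarith
    exact h1.trans h2
  have hpow : M ^ (L * (m + 17 + 1)) * M ^ m * M = M ^ n := by
    rw [hndef, ← pow_add, ← pow_succ]
  have htop : a * M ^ (L * (m + 17 + 1)) * M ^ m + a ≤ R / 2 := by
    set T : ℝ := M ^ (L * (m + 17 + 1)) * M ^ m with hT
    have hT0 : 0 ≤ T := by positivity
    have h1 : a * T * 4 ≤ a * M ^ n := by
      rw [← hpow]
      have h2 : a * T * 4 ≤ a * T * M := mul_le_mul_of_nonneg_left hM4 (by positivity)
      calc a * T * 4 ≤ a * T * M := h2
        _ = a * (M ^ (L * (m + 17 + 1)) * M ^ m * M) := by rw [hT]; ring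
    have h3 : a * M ^ n ≤ R / 4 := by linarith [haR]
    have h4 : a * T ≤ R / 16 := by linarith
    calc a * M ^ (L * (m + 17 + 1)) * M ^ m + a = a * T + a := by rw [hT]; ring
      _ ≤ R / 16 + R / 4 := add_le_add h4 haR4
      _ ≤ R / 2 := by linarith [hR]
  have hMR : M ^ n * a + a / 2 ≤ R := by linarith [haR, haR4]
  -- ===== frames, ladders =====
  have hdisc₁ : ∀ v ∈ meshDomain D.carrier δ, ‖φ.symm (meshPoint δ v)‖ < 2 * M ^ n * a → v ∈ Λ₁ :=
    fun v hv hlt => (hdiscW v hv (hlt.trans_le (by linarith [haR]))).1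
  have hdisc₂ : ∀ v ∈ meshDomain D.carrier δ, ‖φ.symm (meshPoint δ v)‖ < 2 * M ^ n * a → v ∈ Λ₂ :=
    fun v hv hlt => (hdiscW v hv (hlt.trans_le (by linarith [haR]))).2
  have hLad₁ := ladderRSWb_of_le _ (hδ2 G₁ Λ₁ hLA₁' hdisc₁ (a / 2) R hηf hadj₁ hMR) hc₁c₀
  have hLad₂ := ladderRSWb_of_le _ (hδ2 G₂ Λ₂ hLA₂' hdisc₂ (a / 2) R hηf hadj₂ hMR) hc₁c₀
  -- ===== far targets =====
  have far : ∀ {Λ : Finset (Site 2)} {G : SimpleGraph (Site 2)} (hadj' : ∀ e ∈ (G.comap (Subtype.val : ↥Λ → Site 2)).edgeFinset,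
      ∀ u ∈ e, ∀ v ∈ e, (u.1 ∈ meshDomain D.carrier δ ∧ meshPoint δ u.1 ∈ Metric.ball (D.pt 0) (ε / 2)) →
      ‖φ.symm (meshPoint δ u.1)‖ < R → (v.1 ∈ meshDomain D.carrier δ ∧ meshPoint δ v.1 ∈ Metric.ball (D.pt 0) (ε / 2)) ∧
        |‖φ.symm (meshPoint δ v.1)‖ - ‖φ.symm (meshPoint δ u.1)‖| < a / 2)
      (y : ↥Λ), c ≤ dist (meshPoint δ y.1) (D.pt 0) →
      y ∈ (chartFrame D φ (ε / 2) δ Λ (G.comap Subtype.val) (a / 2) R hηf hadj').good →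
        a * M ^ (L * (m + 17 + 1)) * M ^ m + (chartFrame D φ (ε / 2) δ Λ (G.comap Subtype.val) (a / 2) R hηf hadj').η ≤
          (chartFrame D φ (ε / 2) δ Λ (G.comap Subtype.val) (a / 2) R hηf hadj').rad y := by
    intro Λ G hadj' y hyc hgood
    change a * M ^ (L * (m + 17 + 1)) * M ^ m + a / 2 ≤ ‖φ.symm (meshPoint δ y.1)‖
    by_contra hlt
    push Not at hlt
    have hyR : ‖φ.symm (meshPoint δ y.1)‖ < R := by linarith [htop, haR4]
    have hyD : meshPoint δ y.1 ∈ D.carrier := meshDomain_subset_meshVertices _ _ hgood.1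
    have := hRc' _ hyD (hyR.trans_le hRRc)
    exact absurd (this.trans_le (min_le_left _ _)) (not_lt.2 hyc)
  -- ===== base walks =====
  have walk : ∀ {Λ : Finset (Site 2)} {G : SimpleGraph (Site 2)} [G.LocallyFinite] (hLA : LocalAgreement D.carrier (D.pt 0) (ε / 2) δ G Λ)
      (hadj' : ∀ e ∈ (G.comap (Subtype.val : ↥Λ → Site 2)).edgeFinset,
      ∀ u ∈ e, ∀ v ∈ e, (u.1 ∈ meshDomain D.carrier δ ∧ meshPoint δ u.1 ∈ Metric.ball (D.pt 0) (ε / 2)) →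
      ‖φ.symm (meshPoint δ u.1)‖ < R → (v.1 ∈ meshDomain D.carrier δ ∧ meshPoint δ v.1 ∈ Metric.ball (D.pt 0) (ε / 2)) ∧
        |‖φ.symm (meshPoint δ v.1)‖ - ‖φ.symm (meshPoint δ u.1)‖| < a / 2)
      (hxΛ : x ∈ Λ) (hx'Λ : x' ∈ Λ),
      ∃ w : (fromEdgeSet (↑(chartFrame D φ (ε / 2) δ Λ (G.comap Subtype.val) (a / 2) R hηf hadj').E : Set (Sym2 ↥Λ))).Walk
        ⟨x, hxΛ⟩ ⟨x', hx'Λ⟩, ∀ z ∈ w.support,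
          z ∈ (chartFrame D φ (ε / 2) δ Λ (G.comap Subtype.val) (a / 2) R hηf hadj').good ∧
          (chartFrame D φ (ε / 2) δ Λ (G.comap Subtype.val) (a / 2) R hηf hadj').rad z <
            a - (chartFrame D φ (ε / 2) δ Λ (G.comap Subtype.val) (a / 2) R hηf hadj').η := by
    intro Λ G _ hLA hadj' hxΛ hx'Λ
    obtain ⟨w, hw⟩ := hδ3 G Λ hLA ⟨x, hxΛ⟩ ⟨x', hx'Λ⟩ hxm hx'm (hdx.trans_le hr_r₃) (hdx'.trans_le hr_r₃)
    have hle : G.comap (Subtype.val : ↥Λ → Site 2) ≤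
        fromEdgeSet (↑(chartFrame D φ (ε / 2) δ Λ (G.comap Subtype.val) (a / 2) R hηf hadj').E : Set (Sym2 ↥Λ)) := by
      intro u v huv
      rw [fromEdgeSet_adj]
      refine ⟨?_, huv.ne⟩
      rw [Finset.mem_coe, chartFrame_E, mem_edgeFinset]
      exact huv
    refine ⟨w.mapLe hle, fun z hz => ?_⟩
    rw [Walk.support_mapLe_eq_support] at hz
    obtain ⟨hzm, hzb, hzs⟩ := hw z hz
    refine ⟨⟨hzm, hzb⟩, ?_⟩
    change ‖φ.symm (meshPoint δ z.1)‖ < a - a / 2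
    linarith
  obtain ⟨bw₁, hbw₁⟩ := walk hLA₁' hadj₁ hx₁ hx'₁
  obtain ⟨bw₂, hbw₂⟩ := walk hLA₂' hadj₂ hx₂ hx'₂
  -- ===== positivity of the four connections =====
  have pos₁ := rcMeasure_real_openConn_pos_of_walk (q := 2) hp0 hp1 two_pos hx₁ hy₁ w₁
  have pos₁' := rcMeasure_real_openConn_pos_of_walk (q := 2) hp0 hp1 two_pos hx'₁ hy₁ w₁'
  have pos₂ := rcMeasure_real_openConn_pos_of_walk (q := 2) hp0 hp1 two_pos hx₂ hy₂ w₂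
  have pos₂' := rcMeasure_real_openConn_pos_of_walk (q := 2) hp0 hp1 two_pos hx'₂ hy₂ w₂'
  -- ===== the supersolution hypotheses in the brick's shape =====
  have hεJ1' : (1 - c₁) ^ (m / 2) < 1 := hεJ1
  -- ===== the two applications of ABS-TWO =====
  have key₁₂ := hTWO (G₁.comap Subtype.val) (G₂.comap Subtype.val) ι₁ ι₂ W₀
    (chartFrame D φ (ε / 2) δ Λ₁ (G₁.comap Subtype.val) (a / 2) R hηf hadj₁)
    (chartFrame D φ (ε / 2) δ Λ₂ (G₂.comap Subtype.val) (a / 2) R hηf hadj₂)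
    (p := 1 - Real.exp (-2 * criticalBetaTwo)) (q := 2) (c := c₁) (a := a) (M := M) (m := m) (g := 1) (L := L)
    Q xW x'W ⟨y₁, hy₁⟩ ⟨y₂, hy₂⟩ hABSA ⟨hp0, hp1⟩ one_le_two hc₁ hc₁1 ha hM4 hm2 le_rfl hL1 hεJ1'
    (by change a * M ^ (L * (m + 17 + 1) + m + 1) ≤ R; rw [← hndef]; linarith [haR])
    (by change a * M ^ (L * (m + 17 + 1) + m + 1) ≤ R; rw [← hndef]; linarith [haR])
    (by change a / 2 ≤ a; linarith) (by change a / 2 ≤ a; linarith)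
    (Finset.ext fun e => by rw [chartFrame_E, mem_edgeFinset, mem_edgeFinset])
    (Finset.ext fun e => by rw [chartFrame_E, mem_edgeFinset, mem_edgeFinset]) hLad₁ hLad₂
    (fun u v => hadjW u.1 u.2 v.1 v.2)
    (fun w hw v hv => ⟨⟨v.1, hnbrW w.1 w.2 hw v.1 (Or.inl hv)⟩, Subtype.ext rfl⟩)
    (fun w hw v hv => ⟨⟨v.1, hnbrW w.1 w.2 hw v.1 (Or.inr hv)⟩, Subtype.ext rfl⟩)
    (fun w => rfl) (fun w => Iff.rfl)
    (fun v hg hlt => by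
      obtain ⟨h1, h2⟩ := hcoreW v.1 (Or.inl v.2) hg.1 hg.2 (by
        change ‖φ.symm (meshPoint δ v.1)‖ < a * M ^ (L * (m + 17 + 1)) * M ^ m + 2 * (a / 2) at hlt
        linarith [htop, haR4])
      exact ⟨⟨v.1, h1⟩, h2, Subtype.ext rfl⟩)
    (fun v hg hlt => by
      obtain ⟨h1, h2⟩ := hcoreW v.1 (Or.inr v.2) hg.1 hg.2 (by
        change ‖φ.symm (meshPoint δ v.1)‖ < a * M ^ (L * (m + 17 + 1)) * M ^ m + 2 * (a / 2) at hlt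
        linarith [htop, haR4])
      exact ⟨⟨v.1, h1⟩, h2, Subtype.ext rfl⟩)
    ⟨bw₁, hbw₁⟩ ⟨bw₂, hbw₂⟩
    (far hadj₁ ⟨y₁, hy₁⟩ hdy₁) (far hadj₂ ⟨y₂, hy₂⟩ hdy₂)
    pos₁ pos₁' pos₂ pos₂' hQ1 hQstep
  have key₂₁ := hTWO (G₂.comap Subtype.val) (G₁.comap Subtype.val) ι₂ ι₁ W₀
    (chartFrame D φ (ε / 2) δ Λ₂ (G₂.comap Subtype.val) (a / 2) R hηf hadj₂)
    (chartFrame D φ (ε / 2) δ Λ₁ (G₁.comap Subtype.val) (a / 2) R hηf hadj₁)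
    (p := 1 - Real.exp (-2 * criticalBetaTwo)) (q := 2) (c := c₁) (a := a) (M := M) (m := m) (g := 1) (L := L)
    Q xW x'W ⟨y₂, hy₂⟩ ⟨y₁, hy₁⟩ hABSA ⟨hp0, hp1⟩ one_le_two hc₁ hc₁1 ha hM4 hm2 le_rfl hL1 hεJ1'
    (by change a * M ^ (L * (m + 17 + 1) + m + 1) ≤ R; rw [← hndef]; linarith [haR])
    (by change a * M ^ (L * (m + 17 + 1) + m + 1) ≤ R; rw [← hndef]; linarith [haR])
    (by change a / 2 ≤ a; linarith) (by change a / 2 ≤ a; linarith)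
    (Finset.ext fun e => by rw [chartFrame_E, mem_edgeFinset, mem_edgeFinset])
    (Finset.ext fun e => by rw [chartFrame_E, mem_edgeFinset, mem_edgeFinset]) hLad₂ hLad₁
    (fun u v => (hadjW u.1 u.2 v.1 v.2).symm)
    (fun w hw v hv => ⟨⟨v.1, hnbrW w.1 w.2 hw v.1 (Or.inr hv)⟩, Subtype.ext rfl⟩)
    (fun w hw v hv => ⟨⟨v.1, hnbrW w.1 w.2 hw v.1 (Or.inl hv)⟩, Subtype.ext rfl⟩)
    (fun w => rfl) (fun w => Iff.rfl)
    (fun v hg hlt => by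
      obtain ⟨h1, h2⟩ := hcoreW v.1 (Or.inr v.2) hg.1 hg.2 (by
        change ‖φ.symm (meshPoint δ v.1)‖ < a * M ^ (L * (m + 17 + 1)) * M ^ m + 2 * (a / 2) at hlt
        linarith [htop, haR4])
      exact ⟨⟨v.1, h1⟩, h2, Subtype.ext rfl⟩)
    (fun v hg hlt => by
      obtain ⟨h1, h2⟩ := hcoreW v.1 (Or.inl v.2) hg.1 hg.2 (by
        change ‖φ.symm (meshPoint δ v.1)‖ < a * M ^ (L * (m + 17 + 1)) * M ^ m + 2 * (a / 2) at hlt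
        linarith [htop, haR4])
      exact ⟨⟨v.1, h1⟩, h2, Subtype.ext rfl⟩)
    ⟨bw₂, hbw₂⟩ ⟨bw₁, hbw₁⟩
    (far hadj₂ ⟨y₂, hy₂⟩ hdy₂) (far hadj₁ ⟨y₁, hy₁⟩ hdy₁)
    pos₂ pos₂' pos₁ pos₁' hQ1 hQstep
  -- ===== conclusion =====
  have hC : Q L / (1 - (1 - c₁) ^ (m / 2)) ^ 2 ≤ 1 + η' / 2 :=
    div_sq_le_of_small hQL hεJ0 (hεJ_le.trans (min_le_right _ _)) hη' hη'1
  dsimp only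
  exact (abs_div_sub_one_lt_of_mul_le pos₁ pos₁' pos₂ pos₂' key₁₂ key₂₁ hC hη' hη'1).trans_le hη'η

end Summit.CriticalPhenomena.SAWScalingLimit.Theorems.IsingBoundaryRatio

end
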